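import Mathlib
import HarnessLib
import Summits.HubbardSuperconductivity.HubbardSuperconductivity.Theses.KLProgramme
import Summits.HubbardSuperconductivity.HubbardSuperconductivity.Theorems.KLProgrammeKLRegimeSplitOnWindow
import Summits.HubbardSuperconductivity.HubbardSuperconductivity.Theorems.KLProgrammeKLRegimeSplitGeneric
import Summits.HubbardSuperconductivity.HubbardSuperconductivity.Theorems.KLProgrammeDispersionFlowEnvelope
import Summits.HubbardSuperconductivity.HubbardSuperconductivity.Theorems.KLProgrammeFermiSurfaceFST2Constants

/-!
# Route `KLProgramme` — the K3-NAMED glue of the split (DOWNSTREAM of the route file) and the non-vacuity exports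
# (stmt-HubbardSuperconductivity-19937; seat p2; plan g9 06:45:57Z import topology, 07:04:52Z (c1)–(c3), 08:40:31Z Δ5)

`KLProgrammeKLRegimeSplitOnWindow.lean` (upstream: the route file will import it) states the four children AS FILED —
`EngineOn klWindowC`, `BetaSplitOn klWindowC`, `CountertermOn klWindowC`, `TwoPointAssemblyOn klWindowC` (covariance window
`klWindowC = [-1.05, -0.15]`, Hartree-correct assembly) — and proves the glue up to K3 on the analysis window, structurally.
This module imports the ROUTE FILE and closes the last inch BY NAME:

* `KLRegimeInduction : EngineOn klWindowC → BetaSplitOn klWindowC → CountertermOn klWindowC → TwoPointAssemblyOn klWindowC →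
  Summit.HubbardSuperconductivity.HubbardSuperconductivity.Theses.KLProgramme.KLRegimeTwoPointLimit` (S0 enters through the
  route's `MuOfDopingWindow_holds`) — the `--glue-by` theorem of the split edit;
* non-vacuity of the children's binders, as named lemmas (tribunal J (c)): `klE0_pos`, `klE0_le_pi` (the scale grid is genuine),
  `klFrameOK_zero_of_mem` / `klFrameOK_zeroC` / `klFrameOK_zero` (the BARE frame `K = 0` is admissible at every covariance
  potential `μ ∈ [-1.05, -0.15]` ⊇ both windows: the free band's FST II constants `(4+|μ|, -μ/2, √(-μ/2·(4+3μ/2)), -μ/4)` (fs-1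
  `klfs_geomConstants`) dominate `FrameOK`'s `(7, 3/80, 1/2, 3/200)`, and the zero decomposition has the required smoothness),
  `klFrameOK_nonempty`, `klThreshold_eventually` (volume guards are plain thresholds, eventually true along `atTop`).

References: HOME/DECOMP.md v8 §8 (j); HOME/planner-g9/SPLIT-ARCH.md R1–R8; the SplitDefs modules (Parts 1–3, Children, OnWindow).
-/

noncomputable section

namespace Summit.HubbardSuperconductivity.HubbardSuperconductivity.Theorems.KLRegimeSplit

set_option linter.dupNamespace false -- summit = problem name (single-conjunct summit), D-0017

open Real Finset Filter Literature.MathematicalPhysics.QuantumLattice Literature.Probability.LatticeModels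
open Literature.MathematicalPhysics.QuantumLattice.FermiRG
open Summit.HubbardSuperconductivity.HubbardSuperconductivity.Theorems.DispersionFlow
open Summit.HubbardSuperconductivity.HubbardSuperconductivity.Theses.KLProgramme

/-! ## §1 Non-vacuity exports -/

/-- `0 < e₀`. -/
theorem klE0_pos : 0 < klE0 := by norm_num [klE0]

/-- `e₀ ≤ π` (so `klTempScaleIdx β klE0` is the honest number of scales and `IsKLRegime` follows from the regime). -/
theorem klE0_le_pi : klE0 ≤ Real.pi := by
  have := Real.pi_gt_three
  norm_num [klE0]; linarith

/-- The floor `klBetaMin = 128` is positive. -/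
theorem klBetaMin_pos : 0 < klBetaMin := by norm_num [klBetaMin]

/-- Volume / Matsubara guards are plain thresholds: eventually true along `atTop`. -/
theorem klThreshold_eventually (L₀ : ℕ) : ∀ᶠ L : ℕ in atTop, L₀ ≤ L := eventually_ge_atTop L₀

/-- The bare frame's level function is the free band's. -/
theorem frameLevel_zero (μ : ℝ) : frameLevel μ 0 = fun q : Momentum => squareDispersion 1 0 q - μ := by
  funext q; simp [frameLevel]

/-- The bare frame read on `Momentum` is the zero function. -/
theorem evalM_zero : evalM 0 = fun _ : Momentum => (0 : ℝ) := by
  funext q; simp [evalM]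

/-- **The bare frame is admissible at every covariance potential `μ ∈ [-1.05, -0.15]`** (`FrameOK R U N μ 0` for every `R` with
non-negative smoothness constants, every `U`, `N`): the geometric half from fs-1's closed-form FST II constants of the free band,
weakened to `(7, 3/80, 1/2, 3/200)`; the decomposition half with all pieces zero. -/
theorem klFrameOK_zero_of_mem {R : RenConsts} (hR : R.WF) (U : ℝ) (N : ℕ) {μ : ℝ}
    (hμ : μ ∈ Set.Icc (-1.05 : ℝ) (-0.15)) : FrameOK R U N μ 0 := by
  obtain ⟨hμ₁, hμ₂⟩ := hμ
  refine ⟨?_, ?_⟩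
  · -- geometry of the free band on the window
    have h83 : -8 / 3 < μ := by linarith
    have h0 : μ < 0 := by linarith
    have hG := Summit.HubbardSuperconductivity.HubbardSuperconductivity.Theorems.klfs_geomConstants h83 h0
    rw [frameLevel_zero]
    refine GeomConstants.weaken hG ?_ ?_ ?_ ?_ (by norm_num) (by norm_num) (by norm_num)
    · rw [abs_of_neg h0]; linarith
    · linarith
    · apply Real.le_sqrt_of_sq_le
      nlinarith [mul_nonneg (show (0 : ℝ) ≤ μ + 1.05 by linarith) (show (0 : ℝ) ≤ -0.15 - μ by linarith)]
    · linarith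
  · -- the zero decomposition
    refine ⟨fun _ => 0, fun p => by simp, fun n _ j _ q => ?_⟩
    rw [evalM_zero, iteratedFDeriv_fun_zero]
    simp only [Pi.zero_apply, norm_zero]
    exact mul_nonneg (mul_nonneg (hR.2.2 j) (uPow_nonneg j U)) (zpow_nonneg (by norm_num) _)

/-- The bare frame is admissible on the covariance window `klWindowC = [-1.05, -0.15]` of the FILED children (tribunal J (c2)). -/
theorem klFrameOK_zeroC {R : RenConsts} (hR : R.WF) (U : ℝ) (N : ℕ) {μ : ℝ} (hμ : μ ∈ klWindowC) : FrameOK R U N μ 0 :=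
  klFrameOK_zero_of_mem hR U N hμ

/-- The bare frame is admissible on K3's analysis window `klWindow = [-1, -0.15]`. -/
theorem klFrameOK_zero {R : RenConsts} (hR : R.WF) (U : ℝ) (N : ℕ) {μ : ℝ} (hμ : μ ∈ klWindow) : FrameOK R U N μ 0 :=
  klFrameOK_zero_of_mem hR U N ⟨by linarith [hμ.1], hμ.2⟩

/-- Hence `FrameOK` is NON-EMPTY at every point of the filed children's window (tribunal J (c2)). -/
theorem klFrameOK_nonempty {R : RenConsts} (hR : R.WF) (U : ℝ) (N : ℕ) {μ : ℝ} (hμ : μ ∈ klWindowC) :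
    ∃ K : TrigPolyC4v, FrameOK R U N μ K :=
  ⟨0, klFrameOK_zeroC hR U N hμ⟩

/-! ## §2 The K3-named glue (`--glue-by` of the split edit) -/

/-- **`KLRegimeInduction` — the four filed children give the crux K3 `KLRegimeTwoPointLimit` BY NAME**: the upstream glue
`k3_twoPointLimit_of_children` (constants in the staged order, the children run at the covariance potential `μ(δ) - U/2`, strong
induction over the scales, child 2's volume-uniform frame, child 4's Hartree-correct assembly) composed with the route's S0
theorem `MuOfDopingWindow_holds`.  Axioms: standard. -/
theorem KLRegimeInduction (h₃ : EngineOn klWindowC) (h₁ : BetaSplitOn klWindowC) (h₂ : CountertermOn klWindowC)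
    (h₄ : TwoPointAssemblyOn klWindowC) :
    Summit.HubbardSuperconductivity.HubbardSuperconductivity.Theses.KLProgramme.KLRegimeTwoPointLimit :=
  k3_twoPointLimit_of_children h₃ h₁ h₂ h₄ MuOfDopingWindow_holds

/-- The same glue in the route's reading order `Engine → BetaSplit → Counterterm → Assembly → K3` as a single implication. -/
theorem KLRegimeInduction' :
    EngineOn klWindowC → BetaSplitOn klWindowC → CountertermOn klWindowC → TwoPointAssemblyOn klWindowC →
      Summit.HubbardSuperconductivity.HubbardSuperconductivity.Theses.KLProgramme.KLRegimeTwoPointLimit :=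
  fun h₃ h₁ h₂ h₄ => KLRegimeInduction h₃ h₁ h₂ h₄

/-! ## §3 The K3-named glue for the GENERIC children (any predicate bundle) -/

/-- **`KLRegimeInductionP Pr` — for EVERY predicate bundle `Pr : Preds`, the generic children on `klWindowC` give the crux K3
`KLRegimeTwoPointLimit` BY NAME** (`k3_twoPointLimit_of_childrenP` ∘ `MuOfDopingWindow_holds`).  The route's `--glue-by` for
children filed as `EngineP Pr₀ klWindowC`, … at a bundle of record `Pr₀` is the instance `KLRegimeInductionP Pr₀` (named
instances below).  Axioms: standard. -/
theorem KLRegimeInductionP (Pr : Preds) (h₃ : EngineP Pr klWindowC) (h₁ : BetaSplitP Pr klWindowC)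
    (h₂ : CountertermP Pr klWindowC) (h₄ : TwoPointAssemblyP Pr klWindowC) :
    Summit.HubbardSuperconductivity.HubbardSuperconductivity.Theses.KLProgramme.KLRegimeTwoPointLimit :=
  k3_twoPointLimit_of_childrenP h₃ h₁ h₂ h₄ MuOfDopingWindow_holds

/-- The K3-named glue at today's bundle `klPreds` (children `EngineP klPreds klWindowC`, … = `EngineOn klWindowC`, …). -/
theorem KLRegimeInduction_klPreds :
    EngineP klPreds klWindowC → BetaSplitP klPreds klWindowC → CountertermP klPreds klWindowC →
      TwoPointAssemblyP klPreds klWindowC →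
        Summit.HubbardSuperconductivity.HubbardSuperconductivity.Theses.KLProgramme.KLRegimeTwoPointLimit :=
  KLRegimeInductionP klPreds

end Summit.HubbardSuperconductivity.HubbardSuperconductivity.Theorems.KLRegimeSplit

end
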